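import Summits.QuantumFields.YangMills.Theorems.ParabolicTrajectoryLatticeGapOnTrajectoryStepScalingDefs
import Summits.QuantumFields.YangMills.Theorems.ParabolicTrajectoryLatticeGapOnTrajectoryStubRateFloor
import Summits.QuantumFields.YangMills.Theorems.ParabolicTrajectoryLatticeGapOnTrajectorySlabClusteringOS
import HarnessLib

/-!
# Crux `LatticeGapOnTrajectory` (stmt-QuantumFields-10523): the anchor is free for every `κ > 1`
# (helper `tunedBoxGap_of_one_lt`, line `step-scaling-contraction`, served slug `StepScalingSketch`)

Helper file (`--supports stmt-QuantumFields-10523`) sharpening §3 of the vocabulary file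
`…StepScalingDefs` (`torusGapAt_of_exp_le`, `le_zeta_of_exp_le`, `tunedBoxGap_of_exp_le`: the anchor
`TunedBoxGap r sch D κ μ` is free as soon as `4e^μ ≤ κ`, from `‖osCorr‖ ≤ 2B²` and `osVar ≥ −2B²` alone).
Here the two constants are sharpened using the invariances of Wilson's torus measure and reflection
positivity, with the result that the anchor is free for EVERY thermal constant `κ > 1`, eventually along
any scheme with `β_k → ∞` (so that `β_k ≥ 0` eventually), at `μ = min 1 (log κ)`. G-blind bookkeeping;
nothing about mass gaps is asserted.

* §1 (abstract probability) `osCorr_self_eq_integral_centred`: under a probability measure invariant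
  under `Θ` and `τ`, `osCorr μ Θ τ X X = ∫ conj (X(Θω) − a)(X(τω) − a) dμ`, `a = ∫ X`;
  `norm_osCorr_self_le_sq_of_measurePreserving`: hence `‖osCorr μ Θ τ X X‖ ≤ B²` for `‖X‖ ≤ B`
  (AM–GM under the integral, invariance of `∫ ‖X − a‖²` under `Θ` and `τ`, and the variance identity
  `∫ ‖X − a‖² = ∫ ‖X‖² − ‖a‖² ≤ B²`).
* §2 (Wilson's torus) `norm_osCorr_negReflect_timeShift_le_sq` (`Θ₀`- and `τ_n`-invariance of
  `wilsonMeasure`); the SHARP THERMAL FLOOR `torusGapAt_of_exp_le_rp`: for `β ≥ 0`,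
  `TorusGapAt ρ β S (μ/(2S+1)) κ` as soon as `e^μ ≤ κ` (`osVar ≥ 0` by site reflection positivity
  `stub_negReflectRP` in the OS-variance form `HankelSite.osVar_negReflect_nonneg_of_rp_lt`, the thermal
  slack is `≥ κB²e^{−μ} ≥ B² ≥ ‖osCorr‖`); `le_zeta_of_exp_le_rp`; and the registered helper
  `tunedBoxGap_of_one_lt`.

References: Osterwalder–Seiler, Ann. Phys. 110 (1978) 440, §2; Glimm–Jaffe, Quantum Physics (1987),
§6.1, §19.7; Lüscher–Weisz–Wolff, Nucl. Phys. B 359 (1991) 221, §2.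
-/

open scoped ComplexConjugate Topology
open Filter MeasureTheory
open Literature.MathematicalPhysics.QuantumLattice Literature.MathematicalPhysics.QuantumFieldTheory
open Summit.QuantumFields.YangMills.Theses.ParabolicTrajectory
open Summit.QuantumFields.YangMills.Cruxes.LatticeGapOnTrajectory.OrbitKantorovichFiniteSize

noncomputable section

namespace Summit.QuantumFields.YangMills.Cruxes.LatticeGapOnTrajectory.StepScaling

/-! ## §1 The covariance bound `‖osCorr μ Θ τ X X‖ ≤ B²` under `Θ`- and `τ`-invariance -/

section Covariance

variable {Ω : Type*} [MeasurableSpace Ω] {μ : Measure Ω}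

/-- Change of variables for a REAL integrand under a measure-preserving self-map:
`∫ g (τ ω) dμ = ∫ g dμ` (measurable `g`; no injectivity of `τ` needed). -/
theorem integral_real_comp_eq_of_measurePreserving {τ : Ω → Ω} (hτ : MeasurePreserving τ μ μ)
    {g : Ω → ℝ} (hg : Measurable g) : ∫ ω, g (τ ω) ∂μ = ∫ ω, g ω ∂μ := by
  have h := integral_map hτ.measurable.aemeasurable (f := g)
    (hg.aestronglyMeasurable (μ := Measure.map τ μ))
  rw [hτ.map_eq] at h
  exact h.symm

variable [IsProbabilityMeasure μ]

/-- **Centring.** Under a probability measure invariant under `Θ` and `τ`, the reflected, translated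
connected autocorrelation of a bounded measurable `X` is the reflected, translated second moment of the
centred observable: `osCorr μ Θ τ X X = ∫ conj (X(Θω) − a) · (X(τω) − a) dμ` with `a = ∫ X dμ`
(expand; the cross terms are `−a · conj ∫ X∘Θ = −|a|²` and `−conj a · ∫ X∘τ = −|a|²` by invariance). -/
theorem osCorr_self_eq_integral_centred {Θ τ : Ω → Ω} (hΘ : MeasurePreserving Θ μ μ)
    (hτ : MeasurePreserving τ μ μ) {X : Ω → ℂ} (hX : Measurable X) (hXb : ∃ B, ∀ ω, ‖X ω‖ ≤ B) :
    osCorr μ Θ τ X X =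
      ∫ ω, conj (X (Θ ω) - ∫ ω', X ω' ∂μ) * (X (τ ω) - ∫ ω', X ω' ∂μ) ∂μ := by
  obtain ⟨B, hB⟩ := hXb
  unfold osCorr
  set a : ℂ := ∫ ω, X ω ∂μ with ha
  have hXX : Integrable (fun ω => conj (X (Θ ω)) * X (τ ω)) μ :=
    integrable_conj_comp_mul_comp hΘ.measurable hτ.measurable hX ⟨B, hB⟩ hX ⟨B, hB⟩
  have hXΘ : Integrable (fun ω => conj (X (Θ ω))) μ :=
    integrable_of_measurable_bounded (Complex.continuous_conj.measurable.comp (hX.comp hΘ.measurable))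
      ⟨B, fun ω => by rw [RCLike.norm_conj]; exact hB _⟩
  have hXτ : Integrable (fun ω => X (τ ω)) μ :=
    integrable_of_measurable_bounded (hX.comp hτ.measurable) ⟨B, fun ω => hB _⟩
  have hIΘ : ∫ ω, conj (X (Θ ω)) ∂μ = conj a := by
    rw [integral_conj, ha]
    exact congrArg _ (integral_comp_eq_of_measurePreserving hΘ hX)
  have hIτ : ∫ ω, X (τ ω) ∂μ = a := integral_comp_eq_of_measurePreserving hτ hX
  have e : ∀ ω, conj (X (Θ ω) - a) * (X (τ ω) - a) =
      conj (X (Θ ω)) * X (τ ω) - a * conj (X (Θ ω)) - conj a * X (τ ω) + conj a * a := by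
    intro ω; simp only [map_sub]; ring
  simp_rw [e]
  have hQ : Integrable (fun ω => a * conj (X (Θ ω))) μ := hXΘ.const_mul a
  have hR : Integrable (fun ω => conj a * X (τ ω)) μ := hXτ.const_mul (conj a)
  have hPQ : Integrable (fun ω => conj (X (Θ ω)) * X (τ ω) - a * conj (X (Θ ω))) μ := hXX.sub hQ
  have hF : Integrable (fun ω => conj (X (Θ ω)) * X (τ ω) - a * conj (X (Θ ω)) - conj a * X (τ ω)) μ :=
    hPQ.sub hR
  have hS : Integrable (fun _ : Ω => conj a * a) μ := integrable_const _
  rw [integral_add hF hS, integral_sub hPQ hR, integral_sub hXX hQ, integral_const_mul,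
    integral_const_mul, hIΘ, hIτ, integral_const]
  simp only [probReal_univ, one_smul]
  ring

/-- **The covariance bound.** Under a probability measure invariant under `Θ` and `τ`, a bounded
measurable `X` with `‖X‖ ≤ B` has `‖osCorr μ Θ τ X X‖ ≤ B²`: after centring
(`osCorr_self_eq_integral_centred`), AM–GM under the integral gives
`‖osCorr‖ ≤ ½ (∫ ‖Y∘Θ‖² + ∫ ‖Y∘τ‖²) = ∫ ‖Y‖²` (`Y = X − ∫X`, invariance), and
`∫ ‖Y‖² = Re ∫ conj X · X − ‖∫X‖² ≤ B²`. -/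
theorem norm_osCorr_self_le_sq_of_measurePreserving {Θ τ : Ω → Ω} (hΘ : MeasurePreserving Θ μ μ)
    (hτ : MeasurePreserving τ μ μ) {X : Ω → ℂ} (hX : Measurable X) {B : ℝ} (hB : ∀ ω, ‖X ω‖ ≤ B) :
    ‖osCorr μ Θ τ X X‖ ≤ B ^ 2 := by
  set a : ℂ := ∫ ω, X ω ∂μ with ha
  set Y : Ω → ℂ := fun ω => X ω - a with hY
  have hYm : Measurable Y := hX.sub measurable_const
  have hYb : ∀ ω, ‖Y ω‖ ≤ B + ‖a‖ := fun ω =>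
    (norm_sub_le _ _).trans (add_le_add (hB ω) le_rfl)
  -- centring
  have hkey : osCorr μ Θ τ X X = ∫ ω, conj (Y (Θ ω)) * Y (τ ω) ∂μ :=
    osCorr_self_eq_integral_centred hΘ hτ hX ⟨B, hB⟩
  -- integrability of the squared norms
  have hsq : ∀ {φ : Ω → Ω}, Measurable φ → Integrable (fun ω => ‖Y (φ ω)‖ ^ 2) μ := by
    intro φ hφ
    refine Integrable.of_bound ((hYm.comp hφ).norm.pow_const 2).aestronglyMeasurable
      ((B + ‖a‖) ^ 2) (ae_of_all _ fun ω => ?_)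
    rw [Real.norm_eq_abs, abs_pow, abs_norm]
    exact pow_le_pow_left₀ (norm_nonneg _) (hYb _) 2
  have hYY : Integrable (fun ω => conj (Y (Θ ω)) * Y (τ ω)) μ :=
    integrable_conj_comp_mul_comp hΘ.measurable hτ.measurable hYm ⟨_, hYb⟩ hYm ⟨_, hYb⟩
  -- AM–GM under the integral
  have hRi : Integrable (fun ω => (‖Y (Θ ω)‖ ^ 2 + ‖Y (τ ω)‖ ^ 2) / 2) μ :=
    ((hsq hΘ.measurable).add (hsq hτ.measurable)).div_const 2
  have h2 : ‖∫ ω, conj (Y (Θ ω)) * Y (τ ω) ∂μ‖ ≤ ∫ ω, (‖Y (Θ ω)‖ ^ 2 + ‖Y (τ ω)‖ ^ 2) / 2 ∂μ := by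
    refine (norm_integral_le_integral_norm _).trans (integral_mono hYY.norm hRi fun ω => ?_)
    show ‖conj (Y (Θ ω)) * Y (τ ω)‖ ≤ (‖Y (Θ ω)‖ ^ 2 + ‖Y (τ ω)‖ ^ 2) / 2
    rw [norm_mul, RCLike.norm_conj]
    linarith [two_mul_le_add_sq ‖Y (Θ ω)‖ ‖Y (τ ω)‖]
  -- invariance
  have h3 : ∫ ω, (‖Y (Θ ω)‖ ^ 2 + ‖Y (τ ω)‖ ^ 2) / 2 ∂μ = ∫ ω, ‖Y ω‖ ^ 2 ∂μ := by
    have iΘ : ∫ ω, ‖Y (Θ ω)‖ ^ 2 ∂μ = ∫ ω, ‖Y ω‖ ^ 2 ∂μ :=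
      integral_real_comp_eq_of_measurePreserving hΘ (hYm.norm.pow_const 2)
    have iτ : ∫ ω, ‖Y (τ ω)‖ ^ 2 ∂μ = ∫ ω, ‖Y ω‖ ^ 2 ∂μ :=
      integral_real_comp_eq_of_measurePreserving hτ (hYm.norm.pow_const 2)
    rw [integral_div, integral_add (hsq hΘ.measurable) (hsq hτ.measurable), iΘ, iτ]
    ring
  -- the variance identity
  have h4 : ∫ ω, ‖Y ω‖ ^ 2 ∂μ ≤ B ^ 2 := by
    have hYYid : Integrable (fun ω => conj (Y ω) * Y ω) μ :=
      integrable_conj_comp_mul_comp (μ := μ) (Θ := id) (τ := id) measurable_id measurable_id hYm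
        ⟨_, hYb⟩ hYm ⟨_, hYb⟩
    have e1 : ∫ ω, ‖Y ω‖ ^ 2 ∂μ = (∫ ω, conj (Y ω) * Y ω ∂μ).re := by
      have h := integral_re hYYid
      simp only [RCLike.re_to_complex] at h
      rw [← h]
      refine integral_congr_ae (ae_of_all _ fun ω => ?_)
      show ‖Y ω‖ ^ 2 = (conj (Y ω) * Y ω).re
      rw [Complex.conj_mul', ← Complex.ofReal_pow, Complex.ofReal_re]
    have e2 : (∫ ω, conj (Y ω) * Y ω ∂μ) = osCorr μ id id X X :=
      (osCorr_self_eq_integral_centred (MeasurePreserving.id μ) (MeasurePreserving.id μ) hX ⟨B, hB⟩).symm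
    have e3 : (osCorr μ id id X X).re = (∫ ω, conj (X ω) * X ω ∂μ).re - ‖a‖ ^ 2 := by
      simp only [osCorr, id_eq]
      rw [Complex.sub_re, ← ha, Complex.conj_mul', ← Complex.ofReal_pow, Complex.ofReal_re]
    have e4 : (∫ ω, conj (X ω) * X ω ∂μ).re ≤ B ^ 2 := by
      refine (Complex.re_le_norm _).trans ?_
      have hpt : ∀ ω, ‖conj (X ω) * X ω‖ ≤ B * B := fun ω => by
        rw [norm_mul, RCLike.norm_conj]
        exact mul_le_mul (hB _) (hB _) (norm_nonneg _) ((norm_nonneg _).trans (hB ω))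
      have h := norm_integral_le_of_norm_le_const (μ := μ) (Eventually.of_forall hpt)
      simpa [sq] using h
    rw [e1, e2, e3]
    linarith [sq_nonneg ‖a‖]
  calc ‖osCorr μ Θ τ X X‖ = ‖∫ ω, conj (Y (Θ ω)) * Y (τ ω) ∂μ‖ := by rw [hkey]
    _ ≤ ∫ ω, (‖Y (Θ ω)‖ ^ 2 + ‖Y (τ ω)‖ ^ 2) / 2 ∂μ := h2
    _ = ∫ ω, ‖Y ω‖ ^ 2 ∂μ := h3
    _ ≤ B ^ 2 := h4

end Covariance

/-! ## §2 Wilson's torus: the sharp thermal floor and the free anchor for `κ > 1` -/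

section Free

variable {G : Type} [Group G] [TopologicalSpace G] [IsTopologicalGroup G] [CompactSpace G]
  [MeasurableSpace G] [BorelSpace G] {N : ℕ}

/-- **The covariance bound on Wilson's torus**: for a continuous representation, every `β`, every side
`Sd ≥ 1`, every shift `n` and every measurable `X` with `‖X‖ ≤ B`,
`‖osCorr μ Θ₀ τ_n X X‖ ≤ B²` (`μ = wilsonMeasure ρ β` is a probability measure invariant under the site
reflection `Θ₀`, `measurePreserving_negReflect_wilsonMeasure`, and under the time shift `τ_n`,
`wilsonMeasure_map_torusConfigShift`). -/
theorem norm_osCorr_negReflect_timeShift_le_sq {ρ : G →* Matrix (Fin N) (Fin N) ℂ} (hρ : Continuous ρ)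
    (β : ℝ) {Sd : ℕ} [NeZero Sd] (n : ℕ) {X : GaugeConfig 4 Sd G → ℂ} (hX : Measurable X) {B : ℝ}
    (hB : ∀ U, ‖X U‖ ≤ B) :
    ‖osCorr (wilsonMeasure (d := 4) (L := Sd) ρ β) GaugeConfig.negReflect (torusTimeShift Sd n) X X‖ ≤
      B ^ 2 := by
  haveI := isProbabilityMeasure_wilsonMeasure (d := 4) (L := Sd) (G := G) ρ hρ β
  -- adapted from `SlabClustering.osCorr_negReflect_eq_cov` (the time shift preserves Wilson's measure)
  have hτ : MeasurePreserving (torusTimeShift Sd n) (wilsonMeasure (d := 4) (L := Sd) ρ β)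
      (wilsonMeasure ρ β) :=
    ⟨(torusConfigShift _).measurable, by
      unfold torusTimeShift; exact wilsonMeasure_map_torusConfigShift ρ β _⟩
  exact norm_osCorr_self_le_sq_of_measurePreserving (measurePreserving_negReflect_wilsonMeasure ρ hρ β)
    hτ hX hB

/-- **The sharp thermal floor.** For a continuous representation, `β ≥ 0`, every half-side `S`, every
`μ ≥ 0` and every thermal constant with `e^μ ≤ κ`: `TorusGapAt ρ β S (μ/(2S+1)) κ`. Given a slab observable
`X` (`w < S`, so `S ≥ 1`): `0 ≤ osVar μ Θ₀ X` by site reflection positivity of the odd Wilson torus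
(`stub_negReflectRP`, in the OS-variance form `HankelSite.osVar_negReflect_nonneg_of_rp_lt`), the thermal
slack is `≥ κ B² e^{−μ} ≥ B²` (`m (2S+1) = μ`, `2S+1−n−2w ≤ 2S+1`), and `‖osCorr‖ ≤ B²`
(`norm_osCorr_negReflect_timeShift_le_sq`). -/
theorem torusGapAt_of_exp_le_rp {ρ : G →* Matrix (Fin N) (Fin N) ℂ} (hρ : Continuous ρ) {β : ℝ}
    (hβ : 0 ≤ β) (S : ℕ) {μ κ : ℝ} (hμ : 0 ≤ μ) (hκ : Real.exp μ ≤ κ) :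
    TorusGapAt ρ β S (μ / (2 * S + 1)) κ := by
  intro w n X B hX hB hdep hw _hn
  have hS : 1 ≤ S := by omega
  set ν := wilsonMeasure (d := 4) (L := 2 * S + 1) (G := G) ρ β with hν
  set m : ℝ := μ / (2 * S + 1) with hm
  have hT : (0 : ℝ) < 2 * S + 1 := by positivity
  have hm0 : 0 ≤ m := div_nonneg hμ hT.le
  have hC : ‖osCorr ν GaugeConfig.negReflect (torusTimeShift (2 * S + 1) n) X X‖ ≤ B ^ 2 :=
    norm_osCorr_negReflect_timeShift_le_sq hρ β n hX hB
  have hV : 0 ≤ osVar ν GaugeConfig.negReflect X :=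
    Transfer.HankelSite.osVar_negReflect_nonneg_of_rp_lt ρ hρ β (stub_negReflectRP ρ hρ hβ hS)
      hX ⟨B, hB⟩ hw hdep
  have hV' : 0 ≤ osVar ν GaugeConfig.negReflect X * Real.exp (-(m * n)) :=
    mul_nonneg hV (Real.exp_pos _).le
  -- the thermal slack is at least `κ B² e^{-μ} ≥ B²`
  have hexp : Real.exp (-μ) ≤ Real.exp (-(m * ((2 * S + 1 : ℝ) - n - 2 * w))) := by
    rw [Real.exp_le_exp]
    have h1 : m * ((2 * S + 1 : ℝ) - n - 2 * w) ≤ m * (2 * S + 1 : ℝ) :=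
      mul_le_mul_of_nonneg_left
        (by nlinarith [Nat.cast_nonneg (α := ℝ) n, Nat.cast_nonneg (α := ℝ) w]) hm0
    have h2 : m * (2 * S + 1 : ℝ) = μ := by rw [hm]; field_simp
    linarith
  have hκ0 : 0 ≤ κ := (Real.exp_pos μ).le.trans hκ
  have hth : B ^ 2 ≤ κ * B ^ 2 * Real.exp (-(m * ((2 * S + 1 : ℝ) - n - 2 * w))) := by
    have h4 : 1 ≤ κ * Real.exp (-μ) := by
      have := mul_le_mul_of_nonneg_right hκ (Real.exp_pos (-μ)).le
      rwa [← Real.exp_add, add_neg_cancel, Real.exp_zero] at this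
    calc B ^ 2 = 1 * B ^ 2 := (one_mul _).symm
      _ ≤ κ * Real.exp (-μ) * B ^ 2 := mul_le_mul_of_nonneg_right h4 (sq_nonneg B)
      _ = κ * B ^ 2 * Real.exp (-μ) := by ring
      _ ≤ κ * B ^ 2 * Real.exp (-(m * ((2 * S + 1 : ℝ) - n - 2 * w))) :=
          mul_le_mul_of_nonneg_left hexp (mul_nonneg hκ0 (sq_nonneg B))
  linarith

/-- **The step-scaling variable has a free floor under reflection positivity**: `μ ≤ zeta ρ β S κ`
whenever `β ≥ 0`, `0 ≤ μ ≤ 1` and `e^μ ≤ κ` (the rate `μ/(2S+1) ≤ 1` belongs to the set whose supremum is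
`fvGap`, by `torusGapAt_of_exp_le_rp`). -/
theorem le_zeta_of_exp_le_rp {ρ : G →* Matrix (Fin N) (Fin N) ℂ} (hρ : Continuous ρ) {β : ℝ}
    (hβ : 0 ≤ β) (S : ℕ) {μ κ : ℝ} (hμ : 0 ≤ μ) (hμ1 : μ ≤ 1) (hκ : Real.exp μ ≤ κ) :
    μ ≤ zeta ρ β S κ := by
  -- adapted from `le_zeta_of_exp_le` (`…StepScalingDefs` §3), with the sharp thermal floor
  have hT : (0 : ℝ) < 2 * S + 1 := by positivity
  have hT1 : (1 : ℝ) ≤ 2 * S + 1 := by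
    have : (0 : ℝ) ≤ S := Nat.cast_nonneg S
    linarith
  have hmem : μ / (2 * S + 1) ∈ {m : ℝ | 0 ≤ m ∧ m ≤ 1 ∧ TorusGapAt ρ β S m κ} := by
    refine ⟨div_nonneg hμ hT.le, ?_, torusGapAt_of_exp_le_rp hρ hβ S hμ hκ⟩
    rw [div_le_one hT]
    exact hμ1.trans hT1
  have hbdd : BddAbove {m : ℝ | 0 ≤ m ∧ m ≤ 1 ∧ TorusGapAt ρ β S m κ} := ⟨1, fun m hm => hm.2.1⟩
  have hle : μ / (2 * S + 1) ≤ fvGap ρ β S κ := le_csSup hbdd hmem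
  unfold zeta
  calc μ = (2 * S + 1 : ℝ) * (μ / (2 * S + 1)) := by field_simp
    _ ≤ (2 * S + 1 : ℝ) * fvGap ρ β S κ := mul_le_mul_of_nonneg_left hle hT.le

/-- **tunedBoxGap_of_one_lt** (registered G-blind helper of the line `step-scaling-contraction`,
signature verbatim) — THE ANCHOR IS FREE FOR EVERY `κ > 1`: along any scheme with `β_k → ∞` (so that
`β_k ≥ 0` eventually, which is all that is used) and any anchor sides `D`, `TunedBoxGap r sch D κ μ₀` holds
with `μ₀ = min 1 (log κ) > 0`: `e^{μ₀} ≤ e^{log κ} = κ`, and `le_zeta_of_exp_le_rp` applies at every `k` with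
`β_k ≥ 0`. (The hypothesis `1 ≤ D k` eventually is not consumed: `TorusGapAt` is vacuous for `S = 0`.)
Consequently the anchor conjunct of `stub_stepScaling` carries no information whenever `law.κ > 1`. -/
theorem tunedBoxGap_of_one_lt :
    ∀ (G : Type) [Group G] [TopologicalSpace G] [IsTopologicalGroup G] [CompactSpace G]
      [MeasurableSpace G] [BorelSpace G] (r : LatticeRep G) (sch : SpeciesScheme (YMSpecies G)) (D : ℕ → ℕ)
      (κ : ℝ), Tendsto sch.β atTop atTop → (∀ᶠ k in atTop, 1 ≤ D k) → 1 < κ →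
        TunedBoxGap r sch D κ (min 1 (Real.log κ)) := by
  intro G _ _ _ _ _ _ r sch D κ hβ _hD hκ
  have hμ0 : 0 < min 1 (Real.log κ) := lt_min one_pos (Real.log_pos hκ)
  have hμ1 : min 1 (Real.log κ) ≤ 1 := min_le_left _ _
  have hexp : Real.exp (min 1 (Real.log κ)) ≤ κ := by
    calc Real.exp (min 1 (Real.log κ)) ≤ Real.exp (Real.log κ) := Real.exp_le_exp.2 (min_le_right _ _)
      _ = κ := Real.exp_log (by linarith)
  filter_upwards [hβ.eventually_ge_atTop 0] with k hβk
  exact le_zeta_of_exp_le_rp r.continuous hβk (D k) hμ0.le hμ1 hexp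

end Free

end Summit.QuantumFields.YangMills.Cruxes.LatticeGapOnTrajectory.StepScaling

end
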